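import Summits.FinalStateConjecture.FinalStateConjecture.Theorems.EIHFluxBalanceInertialRecessionSchwarzschildLLComponents
import Summits.FinalStateConjecture.FinalStateConjecture.Theorems.EIHFluxBalanceInertialRecessionSchwarzschildLLCalculus
import Summits.FinalStateConjecture.FinalStateConjecture.Theorems.EIHFluxBalanceInertialRecessionStubWindowChargesPointwise

/-!
# Route EIHFluxBalance — crux `InertialRecession`: the Landau–Lifshitz momentum densities of the
# Schwarzschild metric in Kerr–Schild coordinates

Helper file (`--supports stmt-FinalStateConjecture-10166`) for the crux
`Summit.FinalStateConjecture.FinalStateConjecture.Theses.EIHFluxBalance.InertialRecession`: the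
`h^{μ0j}` of `LandauLifshitzPseudotensor.lean` for `Kerr.bilin M 0` (Schwarzschild, Kerr–Schild
form) in closed form off the central axis, and the vanishing of its momentum densities
`Σ_α ∂_α h^{μ0α}` there:
* `hField_schwarzschild_zero_zero_succ` — `h^{00j}(x) = M x_j / (4π r³)` (the Newtonian/Coulomb
  field of the mass `M`);
* `hField_schwarzschild_succ_zero_succ` — `h^{k0j}(x) = −M x_j x_k / (4π r⁴)`;
* `emComplex_schwarzschild_zero` — `Σ_α ∂_α h^{μ0α}(x) = 0` for all `μ` off the axis: the
  Landau–Lifshitz energy–momentum density `(−g)(T^{μ0} + t^{μ0}_LL)` of Schwarzschild VANISHES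
  identically outside the centre (so the quasi-local momentum of every sphere enclosing the centre
  is the same, and it is `(M, 0, 0, 0)` — next file).
Proof: near an off-axis point `Kerr.bilin M 0 = bilinZero M` (`Kerr.bilin_zero_eq_bilinZero`), the
superpotential components are the explicit rational functions of `x̄` of
`…SchwarzschildLLComponents`, and their contracted coordinate derivatives are computed in
`…SchwarzschildLLCalculus`. Virbhadra, Phys. Rev. D 41 (1990) 1086 (`E(r) = M`, all the energy
"confined to the centre", for Kerr–Newman with `Q = a = 0` in Kerr–Schild Cartesian coordinates);
Landau–Lifshitz §96. [cite: LandauLifshitz1975, §96 (96.2)–(96.3)]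
-/

set_option linter.dupNamespace false
-- instance search on the nested operator spaces `E4 →L[ℝ] E4 →L[ℝ] ℝ` is deep
set_option maxSynthPendingDepth 3

noncomputable section

open Set Filter
open scoped Topology RealInnerProductSpace

namespace Summit.FinalStateConjecture.FinalStateConjecture.Theorems

namespace LLSchwarzschild

open Literature.Geometry.Lorentzian Literature.Geometry.Lorentzian.LandauLifshitz
open Literature.Geometry.Lorentzian.Kerr SublinearIsFree.WindowCharges

variable (M : ℝ)

/-! ### Localisation off the axis -/

/-- Off-axis points have off-axis neighbourhoods. [folklore] -/
theorem eventually_spatial_ne_zero {x : E4} (hx : E4.spatial x ≠ 0) :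
    ∀ᶠ z in 𝓝 x, E4.spatial z ≠ 0 :=
  (isOpen_ne_fun E4.spatial.continuous continuous_const).mem_nhds hx

/-- The superpotential depends on the field only through its value at the point. [folklore] -/
theorem superpotential_congr_point {g g' : E4 → E4 →L[ℝ] E4 →L[ℝ] ℝ} {z : E4} (h : g z = g' z)
    (μ α ν β : Fin 4) : superpotential g z μ α ν β = superpotential g' z μ α ν β := by
  simp only [superpotential, upper, metricDet, LandauLifshitz.gram, h]

/-- Near an off-axis point the superpotential of `Kerr.bilin M 0` is that of `bilinZero M`.
[cite: arXiv07060622, (32)–(34)] -/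
theorem superpotential_schwarzschild_eventuallyEq {x : E4} (hx : E4.spatial x ≠ 0)
    (μ α ν β : Fin 4) :
    (fun z ↦ superpotential (Kerr.bilin M 0) z μ α ν β) =ᶠ[𝓝 x]
      fun z ↦ superpotential (bilinZero M) z μ α ν β := by
  filter_upwards [eventually_spatial_ne_zero hx] with z hz
  exact superpotential_congr_point (bilin_zero_eq_bilinZero M hz) μ α ν β

/-- The time partials of the superpotential of `Kerr.bilin M 0` vanish off the axis (staticity:
the components depend on `x̄` only). [cite: arXiv07060622, (32)–(34)] -/
theorem partialDeriv_zero_superpotential_schwarzschild {x : E4} (hx : E4.spatial x ≠ 0)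
    (μ ν β : Fin 4) :
    partialDeriv 0 (fun z ↦ superpotential (Kerr.bilin M 0) z μ 0 ν β) x = 0 := by
  rw [partialDeriv, (superpotential_schwarzschild_eventuallyEq M hx μ 0 ν β).fderiv_eq]
  refine fderiv_apply_eq_zero_of_forall_add_smul fun s ↦ ?_
  exact superpotential_bilinZero_eq_of_spatial_eq M (Kerr.spatial_add_smul_basisVector_zero x s) _ _ _ _

/-! ### The momentum densities `h^{μ0j}` in closed form -/

/-- **`h^{00j} = M x_j / (4π r³)` for Schwarzschild in Kerr–Schild coordinates**, off the axis.
[cite: LandauLifshitz1975, §96 (96.2)–(96.3)] -/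
theorem hField_schwarzschild_zero_zero_succ {x : E4} (hx : E4.spatial x ≠ 0) (j : Fin 3) :
    hField (Kerr.bilin M 0) x 0 0 j.succ =
      M / (4 * Real.pi) * ((E4.spatial x) j / ‖E4.spatial x‖ ^ 3) := by
  rw [hField, Fin.sum_univ_succ, partialDeriv_zero_superpotential_schwarzschild M hx, zero_add]
  -- the spatial partials are those of the explicit momentum potential
  have hl : ∀ l : Fin 3, partialDeriv l.succ
      (fun z ↦ superpotential (Kerr.bilin M 0) z 0 l.succ 0 j.succ) x =
      fderiv ℝ (fun w : E3 ↦ -(if l = j then (1 : ℝ) else 0) * (1 + 2 * M / ‖w‖) +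
        2 * M * (w l * w j / ‖w‖ ^ 3)) (E4.spatial x) (EuclideanSpace.single l 1) := by
    intro l
    have heq : (fun z ↦ superpotential (Kerr.bilin M 0) z 0 l.succ 0 j.succ) =ᶠ[𝓝 x]
        fun z ↦ (fun w : E3 ↦ -(if l = j then (1 : ℝ) else 0) * (1 + 2 * M / ‖w‖) +
          2 * M * (w l * w j / ‖w‖ ^ 3)) (E4.spatial z) := by
      filter_upwards [eventually_spatial_ne_zero hx] with z hz
      rw [superpotential_congr_point (bilin_zero_eq_bilinZero M hz),
        superpotential_bilinZero_zero_succ_zero_succ M hz]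
      simp only [E4.spatial_apply]
      ring
    rw [partialDeriv, heq.fderiv_eq, ← partialDeriv,
      partialDeriv_comp_spatial (differentiableAt_momentumPotential M hx l j), spatial_basisVector_succ]
  simp_rw [hl]
  rw [sum_fderiv_momentumPotential M hx j]
  field_simp
  ring

/-- **`h^{k0j} = −M x_j x_k / (4π r⁴)` for Schwarzschild in Kerr–Schild coordinates**, off the axis.
[cite: LandauLifshitz1975, §96 (96.2)–(96.3)] -/
theorem hField_schwarzschild_succ_zero_succ {x : E4} (hx : E4.spatial x ≠ 0) (k j : Fin 3) :
    hField (Kerr.bilin M 0) x k.succ 0 j.succ =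
      -(M / (4 * Real.pi)) * ((E4.spatial x) j * (E4.spatial x) k / ‖E4.spatial x‖ ^ 4) := by
  rw [hField, Fin.sum_univ_succ, partialDeriv_zero_superpotential_schwarzschild M hx, zero_add]
  have hl : ∀ l : Fin 3, partialDeriv l.succ
      (fun z ↦ superpotential (Kerr.bilin M 0) z k.succ l.succ 0 j.succ) x =
      fderiv ℝ (fun w : E3 ↦ 2 * M * ((if l = j then (1 : ℝ) else 0) * (w k / ‖w‖ ^ 2) -
        (if k = j then (1 : ℝ) else 0) * (w l / ‖w‖ ^ 2))) (E4.spatial x)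
        (EuclideanSpace.single l 1) := by
    intro l
    have heq : (fun z ↦ superpotential (Kerr.bilin M 0) z k.succ l.succ 0 j.succ) =ᶠ[𝓝 x]
        fun z ↦ (fun w : E3 ↦ 2 * M * ((if l = j then (1 : ℝ) else 0) * (w k / ‖w‖ ^ 2) -
          (if k = j then (1 : ℝ) else 0) * (w l / ‖w‖ ^ 2))) (E4.spatial z) := by
      filter_upwards [eventually_spatial_ne_zero hx] with z hz
      rw [superpotential_congr_point (bilin_zero_eq_bilinZero M hz),
        superpotential_bilinZero_succ_succ_zero_succ M hz]
      simp only [E4.spatial_apply]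
      ring
    rw [partialDeriv, heq.fderiv_eq, ← partialDeriv,
      partialDeriv_comp_spatial (differentiableAt_fluxPotential M hx k l j), spatial_basisVector_succ]
  simp_rw [hl]
  rw [sum_fderiv_fluxPotential M hx k j]
  field_simp
  ring

/-! ### The momentum densities vanish off the centre -/

/-- **`Σ_α ∂_α h^{00α} = 0` off the axis** for Schwarzschild: the energy density
`(−g)(T⁰⁰ + t⁰⁰_LL)` vanishes outside the centre (`div (M x̄ / 4π r³) = 0`).
[cite: LandauLifshitz1975, §96 (96.16)] -/
theorem emComplex_schwarzschild_zero_zero {x : E4} (hx : E4.spatial x ≠ 0) :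
    emComplex (Kerr.bilin M 0) x 0 0 = 0 := by
  rw [emComplex_zero_eq_sum_partialDeriv]
  have hl : ∀ l : Fin 3, partialDeriv l.succ (fun z ↦ hField (Kerr.bilin M 0) z 0 0 l.succ) x =
      fderiv ℝ (fun w : E3 ↦ M / (4 * Real.pi) * (w l / ‖w‖ ^ 3)) (E4.spatial x)
        (EuclideanSpace.single l 1) := by
    intro l
    have heq : (fun z ↦ hField (Kerr.bilin M 0) z 0 0 l.succ) =ᶠ[𝓝 x]
        fun z ↦ (fun w : E3 ↦ M / (4 * Real.pi) * (w l / ‖w‖ ^ 3)) (E4.spatial z) := by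
      filter_upwards [eventually_spatial_ne_zero hx] with z hz
      exact hField_schwarzschild_zero_zero_succ M hz l
    rw [partialDeriv, heq.fderiv_eq, ← partialDeriv,
      partialDeriv_comp_spatial (differentiableAt_coulomb M hx l), spatial_basisVector_succ]
  simp_rw [hl]
  exact sum_fderiv_coulomb M hx

/-- **`Σ_α ∂_α h^{k0α} = 0` off the axis** for Schwarzschild: the momentum densities
`(−g)(T^{k0} + t^{k0}_LL)` vanish outside the centre. [cite: LandauLifshitz1975, §96 (96.16)] -/
theorem emComplex_schwarzschild_succ_zero {x : E4} (hx : E4.spatial x ≠ 0) (k : Fin 3) :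
    emComplex (Kerr.bilin M 0) x k.succ 0 = 0 := by
  rw [emComplex_zero_eq_sum_partialDeriv]
  have hl : ∀ l : Fin 3, partialDeriv l.succ (fun z ↦ hField (Kerr.bilin M 0) z k.succ 0 l.succ) x =
      fderiv ℝ (fun w : E3 ↦ -(M / (4 * Real.pi)) * (w l * w k / ‖w‖ ^ 4)) (E4.spatial x)
        (EuclideanSpace.single l 1) := by
    intro l
    have heq : (fun z ↦ hField (Kerr.bilin M 0) z k.succ 0 l.succ) =ᶠ[𝓝 x]
        fun z ↦ (fun w : E3 ↦ -(M / (4 * Real.pi)) * (w l * w k / ‖w‖ ^ 4)) (E4.spatial z) := by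
      filter_upwards [eventually_spatial_ne_zero hx] with z hz
      exact hField_schwarzschild_succ_zero_succ M hz k l
    rw [partialDeriv, heq.fderiv_eq, ← partialDeriv,
      partialDeriv_comp_spatial (differentiableAt_dipoleQuartic M hx l k), spatial_basisVector_succ]
  simp_rw [hl]
  exact sum_fderiv_dipoleQuartic M hx k

/-- **The Landau–Lifshitz momentum densities of Schwarzschild vanish off the centre**:
`Σ_α ∂_α h^{μ0α}(x) = 0` for every `μ` at every off-axis `x`. [cite: LandauLifshitz1975, §96 (96.16)] -/
theorem emComplex_schwarzschild_zero {x : E4} (hx : E4.spatial x ≠ 0) (μ : Fin 4) :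
    emComplex (Kerr.bilin M 0) x μ 0 = 0 := by
  refine Fin.cases ?_ (fun k ↦ ?_) μ
  · exact emComplex_schwarzschild_zero_zero M hx
  · exact emComplex_schwarzschild_succ_zero M hx k


/-- **The Landau–Lifshitz momentum densities of Schwarzschild vanish off the centre**, registered
form (sub-goal `schwarzschild_density_zero` of the crux item). [cite: LandauLifshitz1975, §96 (96.16)] -/
theorem schwarzschild_density_zero : open Literature.Geometry.Lorentzian in ∀ (M : ℝ) (x : E4), E4.spatial x ≠ 0 → ∀ μ : Fin 4, LandauLifshitz.emComplex (Kerr.bilin M 0) x μ 0 = 0 :=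
  fun M _x hx μ ↦ emComplex_schwarzschild_zero M hx μ

end LLSchwarzschild

end Summit.FinalStateConjecture.FinalStateConjecture.Theorems

end
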